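import Summits.Ventures.HSemireg.WedgeCarrierDictionary

/-!
# Venture HSemireg — the carrier bridge (3/3): injectivity for the adapted vacuum; rank dictionaries on the tree carrier

HONEST FRAMING. Part of the Lean index of the computation cell `pub-hsemireg` (seat p3; Sunday enclosure of the
FORMULA-N kernel assets of seats th-7 / th-6, ENCLOSURE-PLAN-p3.md).  Finite-dimensional exterior algebra over a field ONLY:
no variety, no cohomology theory, no semiregularity map is constructed here; nothing here says that HC / HC_CM / HC_AV holds;
no Literature fact is declared or used.  The geometric DICTIONARY (why these ranks are the `HT`-side box ranks of the cell's
STRUCTURE.md §1 / theory/FORMULA-N.md) lives in theory/FORMULA-N-th7.md PART B §A.3 / §N and is NOT asserted in Lean.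

th-7's carrier bridge v2 (993195f303c63fcb) §4 DICTIONARY, part 2 (l.589–770), VERBATIM up to the namespace: injectivity of
the orbit map `Φ_ω` for the adapted vacuum — `ellprod_ne_zero` (`ℓ_0 ∧ ⋯ ∧ ℓ_{n−1}` is a basis monomial), the top monomial of ANY
basis of `W` is a non-zero multiple of `x_{[n]} y_{[n]}` (`⋀^{2n} W` is a line) — hence `Φ_vacuum_injective`,
`Φ_vacuum_bijective` (⋀V IS the free rank-one ⋀W-module on `ω`), and the two RANK DICTIONARIES on the tree carrier:
**`finrank_S_expSum`** (`dim S_k(Σ c_i Π_a(1 + λ_i ℓ_a m_a)) = dim range(θ ↦ θ ∧ Σ c_i Π_a(y_a + λ_i x_a) on ⋀^k W)`) and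
**`finrank_S_pointPair`** (`dim S_k(a·1 + b·ω_V) = dim range(θ ↦ θ ∧ (a·y_{[n]} + b·x_{[n]}))`).  The ASSEMBLY with
`WedgeHankelModel.hankelLaw_model` (C15 on the carrier in every degree) is th-7's PART III: `WedgeC15.lean` / `WedgeC15Laws.lean` /
`WedgeCarrierEcl.lean` / `WedgeC15General.lean`.
-/

open Module
open CliffordAlgebra (contractLeft)
open ExteriorAlgebra (ι)

namespace Summit.Ventures.HSemireg.WedgeBridge

section Dictionary

open Summit.Ventures.HSemireg.ContractionSpan Set Set.powersetCard

variable {K : Type*} [Field K] {n : ℕ} {V : Type*} [AddCommGroup V] [Module K V] (bV : Basis (Fin (n + n)) K V)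

variable (n) in
/-- the index block of the `ℓ`'s. -/
def Xset : Finset (Fin (n + n)) := Finset.univ.filter fun i => (i : ℕ) < n

omit bV in
/-- membership in the `X` block: index `< n`. -/
lemma mem_Xset {i : Fin (n + n)} : i ∈ Xset n ↔ (i : ℕ) < n := by simp [Xset]

omit bV in
/-- `|X| = n`. -/
lemma card_Xset : (Xset n).card = n := by
  have h : Xset n = Finset.univ.map (Fin.castAddEmb n) := by
    ext i
    simp only [mem_Xset, Finset.mem_map, Finset.mem_univ, true_and, Fin.castAddEmb_apply]
    constructor
    · intro hi; exact ⟨⟨i, hi⟩, Fin.ext rfl⟩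
    · rintro ⟨j, rfl⟩; simp
  rw [h, Finset.card_map, Finset.card_univ, Fintype.card_fin]

variable (n) in
/-- the block as an element of `powersetCard`. -/
def Xpc : powersetCard (Fin (n + n)) n := ⟨Xset n, by rw [mem_iff, card_Xset]⟩

omit bV in
/-- the order embedding enumerating the `X` block is `castAdd`. -/
lemma orderEmb_X : ((ofFinEmbEquiv.symm (Xpc n) : Fin n ↪o Fin (n + n)) : Fin n → Fin (n + n)) = Fin.castAdd n := by
  rw [ofFinEmbEquiv_symm_apply]
  symm
  apply Finset.orderEmbOfFin_unique
  · intro i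
    show Fin.castAdd n i ∈ Xset n
    rw [mem_Xset]
    simp
  · exact Fin.strictMono_castAdd n

/-- the basis monomial of the `ℓ`-block is the ordered product `ℓ_0 ∧ ⋯ ∧ ℓ_{n-1}`. -/
lemma basis_Xset_eq_prod :
    bV.ExteriorAlgebra (Xset n) = ((List.finRange n).map fun i => ι K (ℓ bV i)).prod := by
  have h1 : bV.ExteriorAlgebra (Xset n) = bV.ExteriorAlgebra ((Xpc n : powersetCard (Fin (n + n)) n) : Finset _) := rfl
  rw [h1, ExteriorAlgebra.basis_apply_powersetCard]
  show ExteriorAlgebra.ιMulti K n _ = _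
  rw [ExteriorAlgebra.ιMulti_apply, List.ofFn_eq_map]
  congr 1
  apply List.map_congr_left
  intro i _
  show ι K (bV ((ofFinEmbEquiv.symm (Xpc n)) i)) = _
  rw [show ((ofFinEmbEquiv.symm (Xpc n)) i) = Fin.castAdd n i from congrFun orderEmb_X i]
  rfl

/-- `ellprod k` as an ordered `List` product. -/
lemma ellprod_eq : ∀ {k : ℕ}, k ≤ n →
    ellprod bV k = ((List.finRange k).map fun i : Fin k => ι K (ℓN bV (i : ℕ))).prod := by
  intro k
  induction k with
  | zero => intro _; simp [ellprod]
  | succ k ih =>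
    intro hk
    rw [ellprod, ih (by omega), List.finRange_succ_last, List.map_append, List.prod_append, List.map_singleton,
      List.prod_singleton, List.map_map]
    rfl

/-- `ℓ_0 ∧ ⋯ ∧ ℓ_{n-1}` is a basis monomial, hence non-zero. -/
theorem ellprod_ne_zero : ellprod bV n ≠ 0 := by
  have h : ellprod bV n = bV.ExteriorAlgebra (Xset n) := by
    rw [ellprod_eq bV (le_refl n), basis_Xset_eq_prod]
    congr 1
    apply List.map_congr_left
    intro i _
    rw [ℓN, dif_pos i.2]
  rw [h]
  exact bV.ExteriorAlgebra.ne_zero _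

/-- `x_k` is a generator (or `0`). -/
lemma XN_mem (k : ℕ) : XN bV k ∈ LinearMap.range (ι K : W K (Lsp bV) →ₗ[K] ExteriorAlgebra K (W K (Lsp bV))) := by
  rw [XN]
  split_ifs
  · exact LinearMap.mem_range_self _ _
  · exact Submodule.zero_mem _

/-- `y_k` is a generator (or `0`). -/
lemma YN_mem (k : ℕ) : YN bV k ∈ LinearMap.range (ι K : W K (Lsp bV) →ₗ[K] ExteriorAlgebra K (W K (Lsp bV))) := by
  rw [YN]
  split_ifs
  · exact LinearMap.mem_range_self _ _
  · exact Submodule.zero_mem _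

/-- `x_0 ⋯ x_{k-1} ∈ ⋀^k W`. -/
lemma xprod_mem : ∀ k : ℕ, xprod bV k ∈ ⋀[K]^k (W K (Lsp bV))
  | 0 => by rw [xprod, ExteriorAlgebra.exteriorPower, pow_zero]; exact Submodule.one_le.mp le_rfl
  | k + 1 => by
    rw [xprod, ExteriorAlgebra.exteriorPower, pow_succ]
    exact Submodule.mul_mem_mul (xprod_mem k) (XN_mem bV k)

/-- `y_0 ⋯ y_{k-1} ∈ ⋀^k W`. -/
lemma yprod_mem : ∀ k : ℕ, yprod bV k ∈ ⋀[K]^k (W K (Lsp bV))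
  | 0 => by rw [yprod, ExteriorAlgebra.exteriorPower, pow_zero]; exact Submodule.one_le.mp le_rfl
  | k + 1 => by
    rw [yprod, ExteriorAlgebra.exteriorPower, pow_succ]
    exact Submodule.mul_mem_mul (yprod_mem k) (YN_mem bV k)

/-- the explicit top monomial `x_0 ⋯ x_{n-1} y_0 ⋯ y_{n-1}` lies in `Λ^{2n} W`. -/
lemma top_mem : xprod bV n * yprod bV n ∈ ⋀[K]^(n + n) (W K (Lsp bV)) := by
  rw [ExteriorAlgebra.exteriorPower, pow_add]
  exact Submodule.mul_mem_mul (xprod_mem bV n) (yprod_mem bV n)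

/-- **INJECTIVITY of the orbit map for the adapted vacuum** (hence FREENESS, `Φ_bijective`):
the top monomial of ANY basis of `W` is a non-zero multiple of `x_0 ⋯ x_{n-1} y_0 ⋯ y_{n-1}`
(`Λ^{2n} W` is a line), whose image is `ℓ_0 ∧ ⋯ ∧ ℓ_{n-1} ≠ 0`. -/
theorem Φ_vacuum_injective : Function.Injective (Φ K (Lsp bV) (vacuum bV)) := by
  haveI : FiniteDimensional K V := Module.Finite.of_basis bV
  haveI : Module.Free K (W K (Lsp bV)) := free_W (Lsp bV)
  haveI : Module.Finite K (W K (Lsp bV)) := finite_W (Lsp bV)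
  have hdim : Module.finrank K (W K (Lsp bV)) = n + n := by
    rw [finrank_W, Module.finrank_eq_card_basis bV, Fintype.card_fin]
  obtain ⟨bW⟩ : Nonempty (Basis (Fin (Module.finrank K (W K (Lsp bV)))) K (W K (Lsp bV))) :=
    ⟨Module.finBasis K (W K (Lsp bV))⟩
  -- the top monomial of `bW` and the explicit top, both in the line `Λ^{n+n} W`
  have hcard : (Finset.univ : Finset (Fin (Module.finrank K (W K (Lsp bV))))).card = n + n := by
    rw [Finset.card_univ, Fintype.card_fin, hdim]
  have htopW : BB bW Finset.univ ∈ ⋀[K]^(n + n) (W K (Lsp bV)) := by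
    have h1 : bW.ExteriorAlgebra Finset.univ ∈
        ⋀[K]^((Finset.univ : Finset (Fin (Module.finrank K (W K (Lsp bV))))).card) (W K (Lsp bV)) := by
      rw [ExteriorAlgebra.basis_apply]
      exact ExteriorAlgebra.ιMulti_range K _ ⟨_, rfl⟩
    rwa [hcard] at h1
  have hline : Module.finrank K (⋀[K]^(n + n) (W K (Lsp bV))) = 1 := by
    rw [exteriorPower.finrank_eq, hdim, Nat.choose_self]
  have htop' : xprod bV n * yprod bV n ≠ 0 := by
    intro h
    have := Φ_xprod_yprod bV
    rw [h, map_zero] at this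
    exact ellprod_ne_zero bV this.symm
  haveI : Module.Finite K (ExteriorAlgebra K (W K (Lsp bV))) := Module.Finite.of_basis (BB bW)
  have hspan : (K ∙ (xprod bV n * yprod bV n)) = ⋀[K]^(n + n) (W K (Lsp bV)) := by
    apply Submodule.eq_of_le_of_finrank_le
    · exact (Submodule.span_singleton_le_iff_mem _ _).mpr (top_mem bV)
    · rw [hline, finrank_span_singleton htop']
  have hmem : BB bW Finset.univ ∈ K ∙ (xprod bV n * yprod bV n) := by rw [hspan]; exact htopW
  obtain ⟨c, hc'⟩ := Submodule.mem_span_singleton.mp hmem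
  have hc0 : c ≠ 0 := by
    intro h0
    have h1 := congrArg (fun z => (BB bW).repr z Finset.univ) hc'
    rw [h0, zero_smul, map_zero, Basis.repr_self, Finsupp.zero_apply, Finsupp.single_eq_same] at h1
    exact zero_ne_one h1
  refine Φ_injective_of_top bW ?_
  rw [← hc', map_smul, Φ_xprod_yprod]
  exact smul_ne_zero hc0 (ellprod_ne_zero bV)

/-- **FREENESS for the adapted vacuum:** `Φ_ω : Λ W ≃ Λ V`. -/
theorem Φ_vacuum_bijective : Function.Bijective (Φ K (Lsp bV) (vacuum bV)) := by
  haveI : FiniteDimensional K V := Module.Finite.of_basis bV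
  haveI : Module.Free K (W K (Lsp bV)) := free_W (Lsp bV)
  haveI : Module.Finite K (W K (Lsp bV)) := finite_W (Lsp bV)
  have hinj := Φ_vacuum_injective bV
  obtain ⟨bW⟩ : Nonempty (Basis (Fin (Module.finrank K (W K (Lsp bV)))) K (W K (Lsp bV))) :=
    ⟨Module.finBasis K (W K (Lsp bV))⟩
  haveI : Module.Finite K (ExteriorAlgebra K (W K (Lsp bV))) := Module.Finite.of_basis (BB bW)
  haveI : Module.Finite K (ExteriorAlgebra K V) := Module.Finite.of_basis bV.ExteriorAlgebra
  have hdim : Module.finrank K (ExteriorAlgebra K (W K (Lsp bV))) = Module.finrank K (ExteriorAlgebra K V) := by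
    rw [finrank_exteriorAlgebra_eq bW, finrank_exteriorAlgebra_eq bV, Fintype.card_fin, Fintype.card_fin, finrank_W,
      Module.finrank_eq_card_basis bV, Fintype.card_fin]
  exact ⟨hinj, (LinearMap.injective_iff_surjective_of_finrank_eq_finrank hdim).mp hinj⟩

/-- **C15 ON THE CARRIER (rank dictionary):** for every finite exponential sum with coefficients `c_i` and
parameters `λ_i`, the degree-`k` contraction span of `x = Σ_i c_i · Π_a (1 + λ_i ℓ_a ∧ m_a)` (`= Σ c_i exp(λ_i Θ)`,
`Θ = Σ_a ℓ_a ∧ m_a`) has the dimension of the WEDGE-MODEL range of `v = Σ_i c_i · Π_a (y_a + λ_i x_a)` — the object of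
th-6's `vClass` / HankelRank's `w_n(q)` with `q_m = Σ_i c_i λ_i^m` (up to the order-reversal `m ↦ n - m`, which
preserves Hankel rank). -/
theorem finrank_S_expSum {ι' : Type*} (s : Finset ι') (c lam : ι' → K) (k : ℕ) :
    Module.finrank K (S K (Lsp bV) k (∑ i ∈ s, c i • Eprod bV (lam i) n)) =
      Module.finrank K (LinearMap.range (wedge K (Lsp bV) k (∑ i ∈ s, c i • gprod bV (lam i) n))) := by
  have h : Φ K (Lsp bV) (vacuum bV) (∑ i ∈ s, c i • gprod bV (lam i) n) = ∑ i ∈ s, c i • Eprod bV (lam i) n := by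
    rw [map_sum]
    exact Finset.sum_congr rfl fun i _ => by rw [map_smul, Φ_gprod]
  rw [← h]
  exact finrank_S_eq_of_injective (Φ_vacuum_injective bV) k _

/-- **POINT PAIR ON THE CARRIER:** the contraction spans of `a·1 + b·ω_V` (`ω_V = ℓ_0 ∧ ⋯ ∧ ℓ_{n-1} ∧ ω` a top form;
`ch(I_p) = 1 - pt`) have the dimensions of the wedge-model ranges of `a·y_0⋯y_{n-1} + b·x_0⋯x_{n-1}`
(th-7's `pointPair`; PointPairRank gives `2·C(n,k) - [k=0] - [k=n]` for `a, b ≠ 0`). -/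
theorem finrank_S_pointPair (a b : K) (k : ℕ) :
    Module.finrank K (S K (Lsp bV) k (algebraMap K _ a + b • (ellprod bV n * vacuum bV))) =
      Module.finrank K (LinearMap.range (wedge K (Lsp bV) k (a • yprod bV n + b • xprod bV n))) := by
  have h : Φ K (Lsp bV) (vacuum bV) (a • yprod bV n + b • xprod bV n) =
      algebraMap K _ a + b • (ellprod bV n * vacuum bV) := by
    rw [map_add, map_smul, map_smul, Φ_yprod, Φ_xprod, Algebra.algebraMap_eq_smul_one]
  rw [← h]
  exact finrank_S_eq_of_injective (Φ_vacuum_injective bV) k _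

end Dictionary

end Summit.Ventures.HSemireg.WedgeBridge
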